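import Summits.MatrixMultiplication.MatrixMultiplication.Theses.PauliSmithLocalisation

/-!
# MatrixMultiplication / PauliSmithLocalisation — support `SuperquadraticInfinitelyOften`
(stmt-MatrixMultiplication-7992)

Shared support item of the refutation lines PauliSmithLocalisation, SuccinctSecantEquations,
HyperbolicRankMethods and ProbeRankScaling:

  `(∃ δ > 0, ∀ n₀, ∃ n ≥ n₀, n^(2+δ) < R(⟨n,n,n⟩)) → ¬ MatrixMultiplication`.

An infinitely-often superquadratic lower bound for the tensor rank of `⟨n,n,n⟩` over `ℂ` forces
every admissible exponent `β` (`R(⟨n,n,n⟩) = O(n^β)`, Bläser 2013, Def. 5.1) to satisfy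
`2 + δ ≤ β`: otherwise `R(⟨n,n,n⟩) ≤ C·n^β` for all large `n` while `n^(2+δ-β) → ∞`, and the
hypothesis produces a large `n` with `n^(2+δ) < R(⟨n,n,n⟩) ≤ C·n^β < n^(2+δ-β)·n^β = n^(2+δ)`.
Hence `ω(ℂ) = inf ≥ 2 + δ > 2` (`le_csInf`, non-empty by `admissibleExponents_nonempty`), which
contradicts `MatrixMultiplication ↔ ω(ℂ) = 2` (`MatrixMultiplication_iff`). This is the
infinitely-often strengthening of the all-`n` glue
`Literature.not_matrixMultiplication_of_superquadratic_rank` (BorderRankLowerBoundAssembly).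

References: M. Bläser, *Fast Matrix Multiplication*, Theory of Computing Graduate Surveys 5
(2013), §5, Def. 5.1.
-/

noncomputable section

open Filter Asymptotics

namespace Summit.MatrixMultiplication.MatrixMultiplication.Theorems

open Literature.Computability.AlgebraicComplexity

/-- If `n^(2+δ) < R(⟨n,n,n⟩)` for infinitely many `n` (over `ℂ`), then every admissible exponent
`β` of matrix multiplication over `ℂ` satisfies `2 + δ ≤ β`. [folklore] -/
theorem add_le_of_mem_admissibleExponents_of_io_superquadratic {δ β : ℝ}
    (h : ∀ n₀ : ℕ, ∃ n : ℕ, n₀ ≤ n ∧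
      (n : ℝ) ^ (2 + δ) < (tensorRank (matMulTensor ℂ n n n) : ℝ))
    (hβ : β ∈ admissibleExponents ℂ) : 2 + δ ≤ β := by
  by_contra hlt
  rw [not_le] at hlt
  obtain ⟨C, hC⟩ := hβ.bound
  have ht : Tendsto (fun n : ℕ => (n : ℝ) ^ (2 + δ - β)) atTop atTop :=
    (tendsto_rpow_atTop (by linarith)).comp tendsto_natCast_atTop_atTop
  obtain ⟨N, hN⟩ :=
    eventually_atTop.1 (hC.and ((ht.eventually_gt_atTop C).and (eventually_ge_atTop 1)))
  obtain ⟨n, hn, hlt'⟩ := h N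
  obtain ⟨h₁, h₂, h₃⟩ := hN n hn
  have hpos : (0 : ℝ) < n := by exact_mod_cast h₃
  rw [Real.norm_of_nonneg (Nat.cast_nonneg _),
    Real.norm_of_nonneg (Real.rpow_nonneg hpos.le _)] at h₁
  have key : (n : ℝ) ^ (2 + δ) < C * (n : ℝ) ^ β := hlt'.trans_le h₁
  rw [show (2 + δ : ℝ) = (2 + δ - β) + β by ring, Real.rpow_add hpos] at key
  have key' : C * (n : ℝ) ^ β < (n : ℝ) ^ (2 + δ - β) * (n : ℝ) ^ β :=
    mul_lt_mul_of_pos_right h₂ (Real.rpow_pos_of_pos hpos _)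
  exact lt_irrefl _ (key.trans key')

/-- If `n^(2+δ) < R(⟨n,n,n⟩)` for infinitely many `n` (over `ℂ`), then `2 + δ ≤ ω(ℂ)`
(`ω(ℂ) = inf` of the admissible exponents, non-empty by the standard algorithm). [folklore] -/
theorem add_le_omega_of_io_superquadratic {δ : ℝ}
    (h : ∀ n₀ : ℕ, ∃ n : ℕ, n₀ ≤ n ∧
      (n : ℝ) ^ (2 + δ) < (tensorRank (matMulTensor ℂ n n n) : ℝ)) :
    2 + δ ≤ omega ℂ :=
  le_csInf (admissibleExponents_nonempty ℂ)
    fun _ hβ => add_le_of_mem_admissibleExponents_of_io_superquadratic h hβ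

/-- **Support item `SuperquadraticInfinitelyOften` of route PauliSmithLocalisation**
(stmt-MatrixMultiplication-7992), exact route decl: an infinitely-often superquadratic rank lower
bound `n^(2+δ) < R(⟨n,n,n⟩)`, `δ > 0` fixed, contradicts `ω(ℂ) = 2` (`MatrixMultiplication_iff`),
because it forces `ω(ℂ) ≥ 2 + δ` (`add_le_omega_of_io_superquadratic`, the route-independent
form other routes sharing this item can reuse verbatim). [folklore] [cite: Blaser2013, Def. 5.1] -/
theorem superquadraticInfinitelyOften_proof :
    Summit.MatrixMultiplication.MatrixMultiplication.Theses.PauliSmithLocalisation.SuperquadraticInfinitelyOften := by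
  unfold Summit.MatrixMultiplication.MatrixMultiplication.Theses.PauliSmithLocalisation.SuperquadraticInfinitelyOften
  rintro ⟨δ, hδ, h⟩ hM
  rw [_root_.MatrixMultiplication_iff] at hM
  have h2 := add_le_omega_of_io_superquadratic h
  rw [hM] at h2
  linarith

end Summit.MatrixMultiplication.MatrixMultiplication.Theorems
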